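import Summits.CriticalPhenomena.PercolationContinuityZ3.Theorems.Transplant.SkelPhiRootChainN
import Summits.CriticalPhenomena.PercolationContinuityZ3.Theorems.Transplant.SkelPhiRootExcess
import Summits.CriticalPhenomena.PercolationContinuityZ3.Theorems.Transplant.SkelPhiRootBridgeKits
import HarnessLib

/-!
# N1 (the `{±1}` node), (R) column (N1-R-PLAN v2 §4 (R5d)): **THE ROOT RESIDUE AT AN x-DIRECTION FROM THE STEP-I″ INPUTS AT EVERY CENTRE** —
# `Skelφ.rootOblTWAt_of_inputs_x`: `rootOblTWAt_of_bridge` (p288127) with every analytic hypothesis DISCHARGED by its server: the bridge step's kits by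
# `hkits_bridge` (p290473), the long run's kits by p1-g11's `hkits_runX` (p288899) — long run = the x-run schedule `xRunSched n_L ℓ′ h_L R′ q_L N_L` in the
# frame `runX φ c_L n_L h_L σ` —, the two rim excesses by `real_rootRim_le` (p288299) with `Rim k := rootRim t Rπ r₀ (region window k)`; what remains are
# the Step-I″ INPUTS AT EVERY CENTRE for `P_q` (zone, short exit links of both kits, the bridge event, the long x-links), the hop input at the root, the
# seed facts, the footprint/clearance ROOMS (instantiated; discharged numerically by the `FootBox` files at (R6)), the excess radius, and NUMERIC inequalities

builds on p205010 (kernel theorem, internal audit signed; external expert review pending) — nothing in this file uses p205010; nothing here is a claim about the open node.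
Lane `prim-bschramm`, seat `prim-bschramm-p3` (gen 9; design owner + (R) owner); helper file (`--supports stmt-CriticalPhenomena-4575 --as helper`).
[cite: KozmaNitzan2024, §4 p. 28 ((32) at the root), Lemma 10 (pp. 17–21), Lemma 11 (pp. 22–23), Lemma 12 (pp. 23–25)] [cite: MartineauTassion2017, §4.3 Lemma 4.2]
-/

noncomputable section

open MeasureTheory ProbabilityTheory
open scoped ENNReal Classical

namespace Summit.CriticalPhenomena.PercolationContinuityZ3.Theorems

namespace Transplant

namespace Skelφ

open Literature.Probability.Percolation Literature.Probability.LatticeModels SimpleGraph GadgetSystem ProbeHistory HSiteScheme Contour KNCells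
open Literature.Probability.Percolation.KozmaNitzan.Cells (oth sgOf stepVec_apply_fst)
open KNCells.KSchA KNLevels ChainPlanar
open Literature.Barriers.CriticalPhenomena (graphBall mem_graphBall_self graphBall_mono)
open BoxProdZ2 (ConcRadiiG)
open Skel (winGraph RootOblTWAt excess)
open SkelI (tanOff)

variable {V : Type} [DecidableEq V] [Countable V] {G : SimpleGraph V} [G.LocallyFinite] {φ ψc : V → Site 2}

/-- **THE ROOT RESIDUE AT AN x-DIRECTION FROM THE INPUTS AT EVERY CENTRE** (see the module docstring).
[cite: KozmaNitzan2024, §4 p. 28 ((32) at the root), Lemma 10 (pp. 17–21), Lemma 12 (pp. 23–25)] -/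
theorem rootOblTWAt_of_inputs_x {types : Finset V} (hlipφ : Lip G φ) (hstep : Steps G φ) (hfr : Frames G φ types) (hκ : CylConn G φ types)
    {Δg : ℕ} (hΔg : ∀ v, G.degree v ≤ Δg) (hlipc : Lip G ψc) (hwsc : WeakSteps G ψc)
    (P : PCells2) (t : V) (Λ : ConcRadiiG) (q : unitInterval) (δc : ℝ) (du : MDir) {σ : ℤ} (hσ : σ = 1 ∨ σ = -1)
    {Rπ : ℕ} (hRQ : Rπ + 1 ≤ Λ.rQ 0 0) (hRB : Rπ + 1 ≤ Λ.rB 0 0 du) (hRQ' : Rπ + 1 ≤ Λ.rQ 0 ((0 : Site 2) + stepVec du))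
    (hRM : Rπ + 1 ≤ Λ.rM 0 ((0 : Site 2) + stepVec du))
    -- the pinned seed
    {A : Finset V} (htA : t ∈ A) (hAconn : ∀ a ∈ A, PathIn G (↑A : Set V) t a) {ρ : ℕ} (hAρ : ∀ a ∈ A, a ∈ graphBall G t ρ) (hρπ : ρ ≤ Rπ)
    (hAfoot : ∀ a ∈ A, -(5 * (P.r du.1 : ℤ)) + 1 ≤ sgOf du * ψc a du.1 ∧ sgOf du * ψc a du.1 ≤ 5 * (P.r du.1 : ℤ) ∧ |ψc a (oth du.1)| ≤ 5 * (P.r (oth du.1) : ℤ) - 1)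
    {kb : ℕ} (hAk : ∀ a ∈ A, |rootFrame φ t σ a 0| ≤ kb)
    -- the bridge frame, the long run (x-run schedule in the x-frame at `c_L`), level data
    (B : BridgePrm) (hB : BridgeOK B) {nL : ℕ} (hnL : 1 ≤ nL) (cL : V) (hL : ℤ) {kq : ℕ} (hκL : hL.natAbs ≤ kq * nL) (ℓ' R's qB Nr Rl : ℕ)
    (Rlev₁ N₁ j₀₁ j₁₁ Rlev₂ N₂ j₀₂ j₁₂ : ℕ) (hRl₁ : Rlev₁ + 1 ≤ B.R') (hRl₂ : Rlev₂ + 1 ≤ R's) (hj₁ : j₁₁ ≤ Rlev₁) (hj₂ : j₁₂ ≤ Rlev₂)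
    -- rooms (instantiated; discharged numerically at (R6))
    (hfoot₁ : ∀ w ∈ graphBall G t Rπ, rootFrame φ t σ w ∈ Finset.Icc B.regionLo B.regionHi → RootFoot P du (ψc w))
    (hfoot₂ : ∀ k ≤ Nr, ∀ w ∈ graphBall G t Rπ, runX φ cL nL hL σ w ∈ (xRunSched nL ℓ' hL R's qB Nr).region k → RootFoot P du (ψc w))
    (hclear₁ : (kb : ℤ) < B.B₀lo 0 - B.R' - B.pr)
    (hclear₂ : ∀ k ≤ Nr, ∀ w ∈ graphBall G t Rπ, runX φ cL nL hL σ w ∈ (xRunSched nL ℓ' hL R's qB Nr).region k → (kb : ℤ) < rootFrame φ t σ w 0)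
    (hTne₁ : (Win G (rootFrame φ t σ) t (Finset.Icc B.core1Lo B.core1Hi) Rπ).Nonempty)
    (hTne₂ : ∀ k ≤ Nr, (Win G (runX φ cL nL hL σ) t ((xRunSched nL ℓ' hL R's qB Nr).core (k + 1)) Rπ).Nonempty)
    (hx : ∀ w ∈ graphBall G t Rπ, rootFrame φ t σ w ∈ Finset.Icc B.core1Lo B.core1Hi → runX φ cL nL hL σ w ∈ (xRunSched nL ℓ' hL R's qB Nr).core 0)
    (hlastf : ∀ w ∈ graphBall G t Rπ, runX φ cL nL hL σ w ∈ (xRunSched nL ℓ' hL R's qB Nr).core (Nr + 1) → TargetFoot P du (ψc w))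
    -- the hop: the root's own long x side half
    {Δ' : ℕ} {δr : ℕ → ℝ} {η : ℝ} {Qp T₀ : Finset V} (hδr : 0 < δr (0 + 1 + Nr))
    (hlink : 1 - δr (0 + 1 + Nr) < (bondPercolation G q).real (linkIn (↑Qp : Set V) A T₀))
    (hQπ : ∀ w ∈ Qp, w ∈ graphBall G t Rπ) (hQfoot : ∀ w ∈ Qp, RootFoot P du (ψc w))
    (hT₀ : ∀ w ∈ T₀, w ∈ graphBall G t Rπ ∧ rootFrame φ t σ w ∈ Finset.Icc B.B₀lo B.B₀hi)
    -- counts and the accuracy split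
    (hcount₁ : 1 / (1 - (q : ℝ)) ^ (Δ' * N₁) ≤ δr (0 + 1 + Nr) * ((Finset.Icc j₀₁ j₁₁).card : ℝ))
    (hcount₂ : 1 / (1 - (q : ℝ)) ^ (Δ' * N₂) ≤ δr (0 + 1 + Nr) * ((Finset.Icc j₀₂ j₁₂).card : ℝ))
    (hη : η ≤ δr (0 + 1 + Nr) / 2)
    -- THE KITS: constants of the bridge kit `Pb` and of the run kit `Pr`, short region, zone family, short pieces
    (Pb Pr : ApronPrm) {Mz Rs Kmaxb KCmaxb Kmaxr KCmaxr rsb rsr cSb cSr cU r₁ r₂ Rb : ℕ}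
    (hPNb : 1 ≤ Pb.N) (hAb : Pb.A = (Mz : ℤ) + 2)
    (hd1b : Pb.W + Pb.ℓ ≤ Pb.d) (hD1b : Pb.W + Pb.ℓ + Pb.d + 2 ≤ shellD Pb) (hD2b : Pb.ℓ + Rs + Pb.d + 3 ≤ shellD Pb) (hDρb : Rs + 1 ≤ shellD Pb)
    (hℓb : 1 ≤ Pb.ℓ) (hWb : Rs + Pb.ℓ ≤ Pb.W) (hKmaxb : shellD Pb + Pb.W ≤ Kmaxb) (hKCmaxb : shellD Pb + Mz + 1 ≤ KCmaxb)
    (hR'b : cylRadMax G φ types Pb.ℓ (Rs + KCmaxb + (Pb.W + Kmaxb)) ≤ Pb.R')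
    (hwideb : ∀ j ≤ j₁₁, ∀ i, (B.B₀lo - (j : Site 2)) i + 2 * tanOff Pb.ℓs Pb.M ≤ (B.B₀hi + (j : Site 2)) i)
    (hdwb : ∀ j ≤ j₁₁, ∀ i, (B.B₀lo - (j : Site 2)) i + (Pb.d + 2 : ℕ) ≤ (B.B₀hi + (j : Site 2)) i)
    (hDwb : ∀ j ≤ j₁₁, ∀ i, (B.B₀lo - (j : Site 2)) i + ((shellD Pb + 1 + Pb.d + KCmaxb + Rs : ℕ) : ℤ) ≤ (B.B₀hi + (j : Site 2)) i)
    (hTb : (Pb.W : ℤ) + Kmaxb + Pb.ℓ + 1 ≤ tanOff Pb.ℓs Pb.M) (hT'b : (shellD Pb : ℤ) + KCmaxb + Rs ≤ tanOff Pb.ℓs Pb.M)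
    (hr₀b : Pb.N * (tanOff Pb.ℓs Pb.M + 2) + Pb.N * Pb.d + (Pb.W + Kmaxb + Pb.R') + (KCmaxb + Rs) ≤ Pb.r₀) (hRb₀ : Pb.r₀ ≤ Rπ)
    (hrsb : 2 * (1 + Pb.N * (tanOff Pb.ℓs Pb.M + 2) + Pb.N * Pb.d + (Pb.W + Kmaxb + Pb.R') + (KCmaxb + Rs)) ≤ rsb)
    (hcSb : (Pb.N + 1) * (tanOff Pb.ℓs Pb.M + 1) + (Pb.N + 1) * Pb.d + (2 * Pb.W + 1) * (Kmaxb + 1) * (Δg + 1) ^ Pb.R' ≤ cSb)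
    (hEb : j₁₁ + (Pb.N * (tanOff Pb.ℓs Pb.M + 1) + Pb.N * Pb.d + KCmaxb) ≤ B.R')
    (hreachb : r₁ + (Pb.N * (tanOff Pb.ℓs Pb.M + 1) + Pb.N * Pb.d + KCmaxb) ≤ Pb.r₀) (hr₁ : Rb ≤ r₁) (hr₁R : r₁ ≤ Rπ)
    (hPNr : kq + 3 ≤ Pr.N) (hAr : Pr.A = (Mz + 1 : ℕ) * (shearUnit nL hL : ℤ) + 1)
    (hd1r : Pr.W + Pr.ℓ ≤ Pr.d) (hD1r : Pr.W + Pr.ℓ + Pr.d + 2 ≤ shellD Pr) (hD2r : Pr.ℓ + Rs + Pr.d + 3 ≤ shellD Pr) (hDρr : Rs + 1 ≤ shellD Pr)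
    (hℓr : 1 ≤ Pr.ℓ) (hWr : Rs + Pr.ℓ ≤ Pr.W) (hKmaxr : (shellD Pr + Pr.W) * (kq + 1) ≤ Kmaxr) (hKCmaxr : (shellD Pr + Mz + 1) * (kq + 1) ≤ KCmaxr)
    (hR'r : cylRadMax G φ types Pr.ℓ (Rs + KCmaxr + (Pr.W + Kmaxr)) ≤ Pr.R')
    (hwider : ∀ k ≤ Nr, ∀ j ≤ j₁₂, ∀ i, ((xRunSched nL ℓ' hL R's qB Nr).lo k - (j : Site 2)) i + 2 * tanOff Pr.ℓs Pr.M ≤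
      ((xRunSched nL ℓ' hL R's qB Nr).hi k + (j : Site 2)) i)
    (hdwr : ∀ k ≤ Nr, ∀ j ≤ j₁₂, ∀ i, ((xRunSched nL ℓ' hL R's qB Nr).lo k - (j : Site 2)) i + (Pr.d + 2 : ℕ) ≤
      ((xRunSched nL ℓ' hL R's qB Nr).hi k + (j : Site 2)) i)
    (hDwr : ∀ k ≤ Nr, ∀ j ≤ j₁₂, ∀ i, ((xRunSched nL ℓ' hL R's qB Nr).lo k - (j : Site 2)) i + ((shellD Pr + 1 + Pr.d + KCmaxr + Rs : ℕ) : ℤ) ≤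
      ((xRunSched nL ℓ' hL R's qB Nr).hi k + (j : Site 2)) i)
    (hTr : (Pr.W : ℤ) + Kmaxr + Pr.ℓ + 1 ≤ tanOff Pr.ℓs Pr.M) (hT'r : (shellD Pr : ℤ) + KCmaxr + Rs ≤ tanOff Pr.ℓs Pr.M)
    (hr₀r : Pr.N * (tanOff Pr.ℓs Pr.M + 2) + Pr.N * Pr.d + (Pr.W + Kmaxr + Pr.R') + (KCmaxr + Rs) ≤ Pr.r₀) (hRr₀ : Pr.r₀ ≤ Rπ)
    (hrsr : 2 * (1 + Pr.N * (tanOff Pr.ℓs Pr.M + 2) + Pr.N * Pr.d + (Pr.W + Kmaxr + Pr.R') + (KCmaxr + Rs)) ≤ rsr)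
    (hcSr : (Pr.N + 1) * (tanOff Pr.ℓs Pr.M + 1) + (Pr.N + 1) * Pr.d + (2 * Pr.W + 1) * (Kmaxr + 1) * (Δg + 1) ^ Pr.R' ≤ cSr)
    (hEr : j₁₂ + (Pr.N * (tanOff Pr.ℓs Pr.M + 1) + Pr.N * Pr.d + KCmaxr) ≤ R's)
    (hreachr : r₂ + (Pr.N * (tanOff Pr.ℓs Pr.M + 1) + Pr.N * Pr.d + KCmaxr) ≤ Pr.r₀) (hr₂ : Rl ≤ r₂) (hr₂R : r₂ ≤ Rπ)
    (Rg : V → Finset V) (hRg : ∀ c, ∀ u ∈ Rg c, u ∈ graphBall G c Rs) (hRgcard : ∀ c, (Rg c).card ≤ cU) (hcU1 : 1 ≤ cU)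
    (Λc : V → ℕ → Finset V) (kz : ℕ) (hkn : ∀ c, Λc c kz ⊆ Λc c Mz) (hΛ : ∀ c, ∀ v ∈ Λc c Mz, v ∈ Rg c ∧ φ v - φ c ∈ box 2 Mz)
    (hZ : ∀ c, (↑(Λc c Mz) : Set V) ⊆ cyl φ c Mz) (hMz : Mz < nL)
    (Q : ShortPc V) (hQRgb : ∀ i σ₀ c, pexR G φ Q σ i σ₀ c ⊆ Rg c) (hQRgr : ∀ i σ₀ c, pexX G φ Q σ i σ₀ c ⊆ Rg c) (hnS : ∀ c, 1 ≤ Q.nS c)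
    (hexRaw : ∀ c, Mz + 3 ≤ Q.nS c)
    (hexLevb : ∀ c, (Pb.A + 1) * Q.nS c ≤ (Q.nS c : ℤ) * Q.ℓS c - shearUnit (Q.nS c) (Q.hS c) + 1 - |Q.hS c| * Q.nS c)
    (hexLevr : ∀ c, (Pr.A + nL) * Q.nS c ≤
      (nL : ℤ) * ((Q.nS c : ℤ) * Q.ℓS c - shearUnit (Q.nS c) (Q.hS c) + 1) - |(nL : ℤ) * Q.hS c - hL * Q.nS c| * Q.nS c)
    -- the bridge stride at every centre: region, piece, readings, off the zone
    (Qb Fb : V → Finset V)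
    (hQb : ∀ c, ∀ w ∈ Qb c, w ∈ graphBall G c Rb ∧
      rootFrame φ t σ w ∈ Finset.Icc (rootFrame φ t σ c - ((B.pr : ℕ) : Site 2)) (rootFrame φ t σ c + ((B.pr : ℕ) : Site 2)))
    (hFb : ∀ c, ∀ w ∈ Fb c, w ∈ Qb c ∧ rootFrame φ t σ w ∈ Finset.Icc (rootFrame φ t σ c + B.dlo) (rootFrame φ t σ c + B.dhi))
    (hFZ : ∀ c, Disjoint (Fb c) (Λc c Mz))
    -- contact-count budgets of the two kits
    (kk₁ kk₂ : ℕ) (hkN₁ : kk₁ * (Δg + 1) ^ (2 * rsb) ≤ N₁) (hkN₂ : kk₂ * (Δg + 1) ^ (2 * rsr) ≤ N₂)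
    (hk₁ : (1 - (q : ℝ) ^ (1 + Δg * cSb + cSb * cU)) ^ kk₁ ≤ δr (0 + 1 + Nr)) (hk₂ : (1 - (q : ℝ) ^ (1 + Δg * cSr + cSr * cU)) ^ kk₂ ≤ δr (0 + 1 + Nr))
    -- THE STEP-I″ INPUTS AT EVERY CENTRE (all for `P_q`)
    (hzone : ∀ c, 1 - δr (0 + 1 + Nr) ^ 2 < (bondPercolation G q).real (UniqZone.zone G (Λc c) kz Mz))
    (hexitb : ∀ c (i : Fin 2) (σ₀ : ℤˣ), 1 - δr (0 + 1 + Nr) ^ 2 < (bondPercolation G q).real (linkIn (↑(Rg c) : Set V) (Λc c kz) (pexR G φ Q σ i σ₀ c)))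
    (hexitr : ∀ c (i : Fin 2) (σ₀ : ℤˣ), 1 - δr (0 + 1 + Nr) ^ 2 < (bondPercolation G q).real (linkIn (↑(Rg c) : Set V) (Λc c kz) (pexX G φ Q σ i σ₀ c)))
    (hbridge : ∀ c, 1 - δr (0 + 1 + Nr) ^ 2 < (bondPercolation G q).real (linkIn (↑(Qb c) : Set V) (Λc c kz) (Fb c)))
    (hlong : ∀ c (τ : ℤ), 1 - δr (0 + 1 + Nr) ^ 2 < (bondPercolation G q).real
      (linkIn (pgramPrism G φ c nL hL (3 * ℓ') Rl) (Λc c kz) (pgSideHalfW G φ c nL hL ℓ' Rl σ (σ * τ))))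
    -- the excess radius at depth `ρ + 1` (conclusion of `exists_excess_radius_uniform`), below both rim radii
    {R₁ : ℕ}
    (hR₁ : ∀ R', R₁ ≤ R' → ∀ (Rw : ℕ) (D' B' : Finset V), (∀ d ∈ D', d ∈ graphBall G t Rw) →
      (∀ d ∈ D', ∀ d' ∈ D', φ d - φ d' ∈ box 2 (2 * Rπ)) → B' ⊆ D' → (∀ a ∈ B', a ∈ graphBall G t (ρ + 1)) →
        (bondPercolation G q).real (excess G t R' D' B') ≤ η)
    (hR₁b : R₁ ≤ Rπ - Pb.r₀) (hR₁r : R₁ ≤ Rπ - Pr.r₀) :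
    RootOblTWAt G (⟨cellGeomSG₂ G ψc P t Λ, q, δc⟩ : KSchA V ℕ) Δ' δr du := by
  set S : KSchA V ℕ := ⟨cellGeomSG₂ G ψc P t Λ, q, δc⟩ with hSdef
  set U' : Finset V := (S.U0root du).filter fun y => y ∈ graphBall G t Rπ with hU'
  set ψL := runX φ cL nL hL σ with hψL
  have hlipR : Lip G (rootFrame φ t σ) := lip_rootFrame hlipφ t hσ
  have hlipL : Lip G ψL := lip_runX hlipφ hσ hnL cL hL
  set 𝒲₁ := planarWindowWin hlipR t Rπ with h𝒲₁
  set 𝒲₂ := planarWindowWin hlipL t Rπ with h𝒲₂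
  set S₁ := B.bridgeFrame hB with hS₁
  set SN := xRunSched nL ℓ' hL R's qB Nr with hSN
  set S₂ : SchedFrame := SN.toFrame with hS₂
  -- the chain data: rims are the far parts of the region windows
  set P₁ : WinChainData V := ⟨Rlev₁, N₁, j₀₁, j₁₁, t, U', fun k => rootRim t Rπ Pb.r₀ (𝒲₁.stepDF S₁ k)⟩ with hP₁
  set P₂ : WinChainData V := ⟨Rlev₂, N₂, j₀₂, j₁₂, t, U', fun k => rootRim t Rπ Pr.r₀ (𝒲₂.stepDF S₂ k)⟩ with hP₂
  have hS₂N : S₂.N = Nr := rfl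
  have hS₂R : S₂.R' = R's := rfl
  -- footprints ⟹ the root world
  have hU : ∀ {w : V}, w ∈ graphBall G t Rπ → RootFoot P du (ψc w) → w ∈ U' := by
    intro w hw hf
    exact Finset.mem_filter.2 ⟨mem_U0root_of_footprint P t Λ q δc du hlipc hwsc hRQ hRB hRQ' hw hf.1 hf.2.1 hf.2.2, hw⟩
  have hDU₁ : ∀ k ≤ S₁.N, 𝒲₁.stepDF S₁ k ⊆ U' := by
    intro k hk w hw
    obtain rfl : k = 0 := Nat.le_zero.1 hk
    change w ∈ Win G (rootFrame φ t σ) t (S₁.region 0) Rπ at hw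
    rw [mem_Win] at hw
    exact hU hw.1 (hfoot₁ w hw.1 (by simpa [hS₁] using hw.2))
  have hDU₂ : ∀ k ≤ S₂.N, 𝒲₂.stepDF S₂ k ⊆ U' := by
    intro k hk w hw
    change w ∈ Win G ψL t (S₂.region k) Rπ at hw
    rw [mem_Win] at hw
    exact hU hw.1 (hfoot₂ k hk w hw.1 hw.2)
  have hDA₁ : ∀ k ≤ S₁.N, Disjoint (𝒲₁.stepDF S₁ k) A := by
    intro k hk
    obtain rfl : k = 0 := Nat.le_zero.1 hk
    change Disjoint (Win G (rootFrame φ t σ) t (S₁.region 0) Rπ) A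
    refine Finset.disjoint_left.2 fun w hw hwA => ?_
    rw [mem_Win] at hw
    have h1 : B.B₀lo 0 - B.R' - B.pr ≤ rootFrame φ t σ w 0 := BridgePrm.le_of_mem_region (by simpa [hS₁] using hw.2) 0
    have h2 := (abs_le.1 (hAk w hwA)).2
    linarith
  have hDA₂ : ∀ k ≤ S₂.N, Disjoint (𝒲₂.stepDF S₂ k) A := by
    intro k hk
    change Disjoint (Win G ψL t (S₂.region k) Rπ) A
    refine Finset.disjoint_left.2 fun w hw hwA => ?_
    rw [mem_Win] at hw
    have h1 := hclear₂ k hk w hw.1 hw.2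
    have h2 := (abs_le.1 (hAk w hwA)).2
    linarith
  -- the subbox weightings of the region windows under the root-seed law
  have hFA : ∀ e ∈ edgesIn G A, ∀ w ∈ e, w ∈ A := fun e he w hw => ((mem_edgesIn_iff).1 he).2 w hw
  have hWD₁ : ∀ k ≤ S₁.N, IsSubbox (winGraph G t Rπ) (S.W0pin G (edgesIn G A) U') q (𝒲₁.stepDF S₁ k) := fun k hk =>
    Skel.isSubbox_W0pin_win (S := S) t Rπ (U := S.U0root du) (hDU₁ k hk) (KSchA.fresh_of_disjoint hFA (hDA₁ k hk))
  have hWD₂ : ∀ k ≤ S₂.N, IsSubbox (winGraph G t Rπ) (S.W0pin G (edgesIn G A) U') q (𝒲₂.stepDF S₂ k) := fun k hk =>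
    Skel.isSubbox_W0pin_win (S := S) t Rπ (U := S.U0root du) (hDU₂ k hk) (KSchA.fresh_of_disjoint hFA (hDA₂ k hk))
  -- planar diameter of the cut world in `φ`
  have hDm : ∀ d ∈ U' \ A, ∀ d' ∈ U' \ A, φ d - φ d' ∈ box 2 (2 * Rπ) := by
    intro d hd d' hd'
    have h1 : d ∈ graphBall G t Rπ := (Finset.mem_filter.1 (Finset.mem_sdiff.1 hd).1).2
    have h2 : d' ∈ graphBall G t Rπ := (Finset.mem_filter.1 (Finset.mem_sdiff.1 hd').1).2
    rw [mem_box]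
    intro i
    have ha := abs_le.1 (abs_sub_le_of_mem_graphBall hlipφ h1 i)
    have hb := abs_le.1 (abs_sub_le_of_mem_graphBall hlipφ h2 i)
    simp only [Pi.sub_apply]
    push_cast
    constructor <;> linarith
  -- rim excesses
  have hexc₁ : ∀ k ≤ S₁.N, (prodBernoulli (S.W0pin G (edgesIn G A) U')).real (⋃ t' ∈ P₁.Rim k, openConn t t') ≤ η := fun k hk =>
    real_rootRim_le (S := S) (du := du) htA hAρ (hDU₁ k hk) (hDA₁ k hk) hR₁ hR₁b hDm
  have hexc₂ : ∀ k ≤ S₂.N, (prodBernoulli (S.W0pin G (edgesIn G A) U')).real (⋃ t' ∈ P₂.Rim k, openConn t t') ≤ η := fun k hk =>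
    real_rootRim_le (S := S) (du := du) htA hAρ (hDU₂ k hk) (hDA₂ k hk) hR₁ hR₁r hDm
  -- the kits of the bridge step
  have hkits₁ : ∀ k ≤ S₁.N, ∀ j ∈ Finset.Icc P₁.j₀ P₁.j₁, ∃ (σk : SData V) (Sz : Finset V),
      SHyp (P₁.stepLF 𝒲₁ S₁ k) j σk ∧ σk.N ≤ P₁.N ∧ (1 - (q : ℝ) ^ σk.sB) ^ σk.k ≤ δr (0 + 1 + S₂.N) ∧ Sz ⊆ (P₁.stepLF 𝒲₁ S₁ k).X j ∧
      Sz ⊆ 𝒲₁.stepDF S₁ k ∧ (∀ x ∈ σk.K, ∀ e' ∈ σk.seed x, e' ∉ wireSet (↑Sz : Set V)) ∧ (∀ x ∈ σk.K, σk.face x ⊆ Sz) ∧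
      (∀ x ∈ σk.K, 1 - 3 * δr (0 + 1 + S₂.N) ≤ (prodBernoulli (S.W0pin G (edgesIn G A) U')).real {ω | ∃ u ∈ σk.face x,
        1 - δr (0 + 1 + S₂.N) < (prodBernoulli (pinW (S.W0pin G (edgesIn G A) U') (wireSet (↑Sz : Set V)) ω)).real
          (⋃ t' ∈ P₁.coreEF 𝒲₁ S₁ k, openConnIn (↑(𝒲₁.stepDF S₁ k) : Set V) u t')}) := by
    intro k hk j hj
    obtain rfl : k = 0 := Nat.le_zero.1 hk
    have hjle : j ≤ j₁₁ := (Finset.mem_Icc.1 hj).2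
    -- level ⊆ region window; core `1` window ⊆ enlarged target; far part of the level in the rim
    have hXD : winLevel G (rootFrame φ t σ) t Rπ B.B₀lo B.B₀hi j ⊆ 𝒲₁.stepDF S₁ 0 := by
      change Win G (rootFrame φ t σ) t (Finset.Icc (B.B₀lo - (j : Site 2)) (B.B₀hi + (j : Site 2))) Rπ ⊆ Win G (rootFrame φ t σ) t (S₁.region 0) Rπ
      refine Win_mono G _ ?_ le_rfl
      rw [hS₁, BridgePrm.bridgeFrame_region]
      exact (S₁.icc_enlarge_mono 0 (show j ≤ B.R' by omega)).trans BridgePrm.enl_subset_region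
    have hPD : Win G (rootFrame φ t σ) t (Finset.Icc B.regionLo B.regionHi) Rπ ⊆ 𝒲₁.stepDF S₁ 0 := subset_rfl
    have hPT : Win G (rootFrame φ t σ) t (Finset.Icc B.core1Lo B.core1Hi) Rπ ⊆ P₁.coreEF 𝒲₁ S₁ 0 := Finset.subset_union_left
    have hfarT : ∀ v ∈ winLevel G (rootFrame φ t σ) t Rπ B.B₀lo B.B₀hi j, v ∉ graphBall G t (Rπ - Pb.r₀) → v ∈ P₁.coreEF 𝒲₁ S₁ 0 :=
      fun v hv hfar => Finset.mem_union_right _ (Finset.mem_filter.2 ⟨hXD hv, hfar⟩)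
    exact hkits_bridge hlipφ hstep hfr hκ hΔg hδr t hσ B Pb hPNb hAb hd1b hD1b hD2b hDρb hℓb hWb hKmaxb hKCmaxb hR'b (hwideb j hjle) (hdwb j hjle)
      (hDwb j hjle) hTb hT'b hr₀b hRb₀ hrsb hcSb (le_trans (by omega) hEb) hreachb hr₁ hr₁R Rg hRg hRgcard hcU1 Λc kz hkn hΛ Q hQRgb hnS hexRaw
      hexLevb Qb Fb hQb hFb hFZ kk₁ t U' (hWD₁ 0 le_rfl) hPD hXD hPT hfarT hkN₁ hk₁ hzone hexitb hbridge
  -- the kits of the long run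
  have hkits₂ : ∀ k ≤ S₂.N, ∀ j ∈ Finset.Icc P₂.j₀ P₂.j₁, ∃ (σk : SData V) (Sz : Finset V),
      SHyp (P₂.stepLF 𝒲₂ S₂ k) j σk ∧ σk.N ≤ P₂.N ∧ (1 - (q : ℝ) ^ σk.sB) ^ σk.k ≤ δr (0 + 1 + S₂.N) ∧ Sz ⊆ (P₂.stepLF 𝒲₂ S₂ k).X j ∧
      Sz ⊆ 𝒲₂.stepDF S₂ k ∧ (∀ x ∈ σk.K, ∀ e' ∈ σk.seed x, e' ∉ wireSet (↑Sz : Set V)) ∧ (∀ x ∈ σk.K, σk.face x ⊆ Sz) ∧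
      (∀ x ∈ σk.K, 1 - 3 * δr (0 + 1 + S₂.N) ≤ (prodBernoulli (S.W0pin G (edgesIn G A) U')).real {ω | ∃ u ∈ σk.face x,
        1 - δr (0 + 1 + S₂.N) < (prodBernoulli (pinW (S.W0pin G (edgesIn G A) U') (wireSet (↑Sz : Set V)) ω)).real
          (⋃ t' ∈ P₂.coreEF 𝒲₂ S₂ k, openConnIn (↑(𝒲₂.stepDF S₂ k) : Set V) u t')}) := by
    intro k hk j hj
    have hjle : j ≤ j₁₂ := (Finset.mem_Icc.1 hj).2
    have hXD : winLevel G ψL t Rπ (SN.lo k) (SN.hi k) j ⊆ 𝒲₂.stepDF S₂ k := by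
      change Win G ψL t (Finset.Icc (SN.lo k - (j : Site 2)) (SN.hi k + (j : Site 2))) Rπ ⊆ Win G ψL t (S₂.region k) Rπ
      exact Win_mono G _ ((S₂.icc_enlarge_mono k (show j ≤ S₂.R' by rw [hS₂R]; omega)).trans (S₂.encl k hk)) le_rfl
    have hPD : Win G ψL t (SN.region k) Rπ ⊆ 𝒲₂.stepDF S₂ k := subset_rfl
    have hPT : Win G ψL t (SN.core (k + 1)) Rπ ⊆ P₂.coreEF 𝒲₂ S₂ k := Finset.subset_union_left
    have hfarT : ∀ v ∈ winLevel G ψL t Rπ (SN.lo k) (SN.hi k) j, v ∉ graphBall G t (Rπ - Pr.r₀) → v ∈ P₂.coreEF 𝒲₂ S₂ k :=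
      fun v hv hfar => Finset.mem_union_right _ (Finset.mem_filter.2 ⟨hXD hv, hfar⟩)
    exact hkits_runX hlipφ hstep hfr hκ hΔg hδr hnL cL hL hσ hκL ℓ' R's qB Nr Pr hPNr hAr hd1r hD1r hD2r hDρr hℓr hWr hKmaxr hKCmaxr hR'r
      (hwider k hk j hjle) (hdwr k hk j hjle) (hDwr k hk j hjle) hTr hT'r hr₀r hRr₀ hrsr hcSr (le_trans (by omega) hEr) hreachr hr₂ hr₂R
      Rg hRg hRgcard hcU1 Λc kz hkn hΛ hZ hMz Q hQRgr hnS hexRaw hexLevr kk₂ t U' (hWD₂ k hk) hPD hXD hPT hfarT hkN₂ hk₂ hzone hexitr (hlong)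
  -- assemble
  exact rootOblTWAt_of_bridge hlipφ hlipc hwsc hlipL P t Λ q δc du hσ hRQ hRB hRQ' hRM htA hAconn (fun a ha => graphBall_mono G t hρπ (hAρ a ha))
    hAfoot hAk B hB S₂ P₁ P₂ rfl rfl rfl rfl (fun k => rootRim_subset t Rπ Pb.r₀ _) (fun k => rootRim_subset t Rπ Pr.r₀ _) hRl₁ hRl₂ hj₁ hj₂
    hfoot₁ hfoot₂ hclear₁ hclear₂ hTne₁ hTne₂ hx hlastf hlink hQπ hQfoot hT₀ hcount₁ hcount₂ hkits₁ hkits₂ hη hexc₁ hexc₂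

end Skelφ

end Transplant

end Summit.CriticalPhenomena.PercolationContinuityZ3.Theorems

end
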